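import Summits.CriticalPhenomena.CardyFormulaZ2.Theorems.CardySusyWardParafermionFamiliesToSLESixTouchLowerBoundA
import Literature.Probability.Percolation.BoxCrossingProofs

/-!
# Touch lower bound on diagonal free walls (stub `stub_touchLowerBound`, reshape r2, of the line
# `exact-potential-schwarz-christoffel`, crux stmt-CriticalPhenomena-10814), B: the line and the mesh near a flat
# diagonal wall

Helper file (deterministic geometry, part 1 of 2). A domain `Ω` contains the open one-sided box
`{|a x - b y - t₀| < wτ, c - wν < a x + b y < c}` under the diagonal line `{a x + b y = c}` (`a, b = ±1`) and
misses the box `{|a x - b y - t₀| < wτ, c < a x + b y < c + wν}` above it. At mesh `δ`, with `k` the last lattice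
level under the line (`δ k < c ≤ δ (k+1)`; level `= a v₀ + b v₁`, column `= a v₀ - b v₁`):

* `level_meshPoint`, `column_meshPoint`, `level_add_normal`, `dist_add_normal_le`: coordinates;
* `not_mem_of_line`, `frontier_of_line`, `mem_closure_of_level_le`, `exists_frontier_above`: the piece of the line
  in the box lies on `∂Ω`, off `Ω`; the point of the line straight above a point of the lower box;
* `mem_meshVertices_of_level_le`, `not_mem_meshVertices_of_lt_level`: sites of level `≤ k` in the lower box are
  mesh vertices, sites of level `≥ k + 1` under the height `c + wν` are not;
* `meshGraph_adj_of_mem_box`: lattice neighbours in the closed lower box are mesh-graph neighbours (convexity);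
* `not_mem_zdArcA_of_lt` (registered one-line ticket `stub_touch_wallB`).
-/

noncomputable section

namespace Summit.CriticalPhenomena.CardyFormulaZ2.Theorems.ParafermionFamiliesToSLESix.TouchLowerBound

open Set Metric Complex
open Literature.Probability.LatticeModels Literature.Probability.Percolation

variable {Ω : Set ℂ} {δ c t₀ wτ wν : ℝ} {a b k : ℤ}

/-! ## Coordinates -/

/-- The level of a mesh point: `a Re(δ v) + b Im(δ v) = δ (a v₀ + b v₁)`. [folklore] -/
theorem level_meshPoint (δ : ℝ) (a b : ℤ) (v : Site 2) :
    (a : ℝ) * (meshPoint δ v).re + b * (meshPoint δ v).im = δ * ((a * v 0 + b * v 1 : ℤ) : ℝ) := by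
  rw [meshPoint_re, meshPoint_im]; push_cast; ring

/-- The column of a mesh point: `a Re(δ v) - b Im(δ v) = δ (a v₀ - b v₁)`. [folklore] -/
theorem column_meshPoint (δ : ℝ) (a b : ℤ) (v : Site 2) :
    (a : ℝ) * (meshPoint δ v).re - b * (meshPoint δ v).im = δ * ((a * v 0 - b * v 1 : ℤ) : ℝ) := by
  rw [meshPoint_re, meshPoint_im]; push_cast; ring

/-- `a² = 1` for a sign. [folklore] -/
theorem sign_mul_self (ha : a = 1 ∨ a = -1) : a * a = 1 := by
  rcases ha with rfl | rfl <;> norm_num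

/-- The normal vector `a + b i` of the line has norm `√2`. [folklore] -/
theorem norm_normal (ha : a = 1 ∨ a = -1) (hb : b = 1 ∨ b = -1) :
    ‖((a : ℝ) : ℂ) + ((b : ℝ) : ℂ) * I‖ = Real.sqrt 2 := by
  rw [Complex.norm_eq_sqrt_sq_add_sq]
  congr 1
  simp only [add_re, ofReal_re, mul_re, I_re, mul_zero, ofReal_im, I_im, mul_one, sub_self, add_zero,
    add_im, mul_im, zero_add]
  rcases ha with rfl | rfl <;> rcases hb with rfl | rfl <;> norm_num

/-- Moving by `t (a + b i)` raises the level by `2t` and keeps the column. [folklore] -/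
theorem level_add_normal (ha : a = 1 ∨ a = -1) (hb : b = 1 ∨ b = -1) (z : ℂ) (t : ℝ) :
    (a : ℝ) * (z + t * (((a : ℝ) : ℂ) + ((b : ℝ) : ℂ) * I)).re + b * (z + t * (((a : ℝ) : ℂ) + ((b : ℝ) : ℂ) * I)).im =
      (a * z.re + b * z.im) + 2 * t ∧
    (a : ℝ) * (z + t * (((a : ℝ) : ℂ) + ((b : ℝ) : ℂ) * I)).re - b * (z + t * (((a : ℝ) : ℂ) + ((b : ℝ) : ℂ) * I)).im =
      a * z.re - b * z.im := by
  have ha2 : (a : ℝ) * a = 1 := by exact_mod_cast sign_mul_self ha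
  have hb2 : (b : ℝ) * b = 1 := by exact_mod_cast sign_mul_self hb
  simp only [add_re, mul_re, ofReal_re, ofReal_im, I_re, I_im, add_im, mul_im, mul_zero, mul_one, sub_zero,
    zero_mul, add_zero, sub_self, zero_add]
  constructor
  · linear_combination t * ha2 + t * hb2
  · linear_combination t * ha2 - t * hb2

/-- The distance moved by `t (a + b i)` is at most `2|t|`. [folklore] -/
theorem dist_add_normal_le (ha : a = 1 ∨ a = -1) (hb : b = 1 ∨ b = -1) (z : ℂ) (t : ℝ) :
    dist z (z + t * (((a : ℝ) : ℂ) + ((b : ℝ) : ℂ) * I)) ≤ 2 * |t| := by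
  rw [dist_eq_norm, sub_add_cancel_left, norm_neg, norm_mul, norm_normal ha hb, Complex.norm_real,
    Real.norm_eq_abs]
  have h2 : Real.sqrt 2 < 2 := by
    rw [Real.sqrt_lt' (by norm_num)]; norm_num
  nlinarith [abs_nonneg t, h2, Real.sqrt_nonneg 2]

/-! ## The line -/

/-- **Points of the line in the box are off `Ω`** (`Ω` is open and the points just above are off `Ω`).
[folklore] -/
theorem not_mem_of_line (hΩ : IsOpen Ω) (ha : a = 1 ∨ a = -1) (hb : b = 1 ∨ b = -1) (hwν : 0 < wν)
    (hout : ∀ z : ℂ, |a * z.re - b * z.im - t₀| < wτ → c < a * z.re + b * z.im → a * z.re + b * z.im < c + wν → z ∉ Ω)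
    {z : ℂ} (hτ : |a * z.re - b * z.im - t₀| < wτ) (hν : (a : ℝ) * z.re + b * z.im = c) : z ∉ Ω := by
  intro hz
  obtain ⟨r, hr, hball⟩ := Metric.isOpen_iff.1 hΩ z hz
  set t : ℝ := min (r / 4) (wν / 4) with ht
  have ht0 : 0 < t := by positivity
  have htr : t ≤ r / 4 := min_le_left _ _
  have htw : t ≤ wν / 4 := min_le_right _ _
  obtain ⟨h1, h2⟩ := level_add_normal ha hb z t
  have hmem : z + t * (((a : ℝ) : ℂ) + ((b : ℝ) : ℂ) * I) ∈ ball z r := by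
    rw [mem_ball, dist_comm]
    have := dist_add_normal_le ha hb z t
    rw [abs_of_pos ht0] at this
    linarith
  refine hout _ ?_ ?_ ?_ (hball hmem)
  · rw [h2]; exact hτ
  · rw [h1]; linarith
  · rw [h1]; linarith

/-- **Points of the line in the box lie on `∂Ω`** (limits of the points just below). [folklore] -/
theorem frontier_of_line (hΩ : IsOpen Ω) (ha : a = 1 ∨ a = -1) (hb : b = 1 ∨ b = -1) (hwν : 0 < wν)
    (hin : ∀ z : ℂ, |a * z.re - b * z.im - t₀| < wτ → c - wν < a * z.re + b * z.im → a * z.re + b * z.im < c → z ∈ Ω)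
    (hout : ∀ z : ℂ, |a * z.re - b * z.im - t₀| < wτ → c < a * z.re + b * z.im → a * z.re + b * z.im < c + wν → z ∉ Ω)
    {z : ℂ} (hτ : |a * z.re - b * z.im - t₀| < wτ) (hν : (a : ℝ) * z.re + b * z.im = c) : z ∈ frontier Ω := by
  rw [frontier, hΩ.interior_eq]
  refine ⟨Metric.mem_closure_iff.2 fun ε hε => ?_, not_mem_of_line hΩ ha hb hwν hout hτ hν⟩
  set t : ℝ := min (ε / 4) (wν / 4) with ht
  have ht0 : 0 < t := by positivity
  have htr : t ≤ ε / 4 := min_le_left _ _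
  have htw : t ≤ wν / 4 := min_le_right _ _
  obtain ⟨h1, h2⟩ := level_add_normal ha hb z (-t)
  refine ⟨z + ((-t : ℝ) : ℂ) * (((a : ℝ) : ℂ) + ((b : ℝ) : ℂ) * I), hin _ ?_ ?_ ?_, ?_⟩
  · rw [h2]; exact hτ
  · rw [h1]; linarith
  · rw [h1]; linarith
  · have := dist_add_normal_le ha hb z (-t)
    rw [abs_neg, abs_of_pos ht0] at this
    linarith

/-- **Above the line, no point of `Ω`**: a point of the box of level in `[c, c + wν)` is off `Ω`. [folklore] -/
theorem not_mem_of_le_level (hΩ : IsOpen Ω) (ha : a = 1 ∨ a = -1) (hb : b = 1 ∨ b = -1) (hwν : 0 < wν)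
    (hout : ∀ z : ℂ, |a * z.re - b * z.im - t₀| < wτ → c < a * z.re + b * z.im → a * z.re + b * z.im < c + wν → z ∉ Ω)
    {z : ℂ} (hτ : |a * z.re - b * z.im - t₀| < wτ) (hν₁ : c ≤ (a : ℝ) * z.re + b * z.im)
    (hν₂ : (a : ℝ) * z.re + b * z.im < c + wν) : z ∉ Ω := by
  rcases hν₁.lt_or_eq with h | h
  · exact hout z hτ h hν₂
  · exact not_mem_of_line hΩ ha hb hwν hout hτ h.symm

/-- Points of the closed-above box `{|column - t₀| < wτ, c - wν < level ≤ c}` lie in `closure Ω`. [folklore] -/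
theorem mem_closure_of_level_le (hΩ : IsOpen Ω) (ha : a = 1 ∨ a = -1) (hb : b = 1 ∨ b = -1) (hwν : 0 < wν)
    (hin : ∀ z : ℂ, |a * z.re - b * z.im - t₀| < wτ → c - wν < a * z.re + b * z.im → a * z.re + b * z.im < c → z ∈ Ω)
    (hout : ∀ z : ℂ, |a * z.re - b * z.im - t₀| < wτ → c < a * z.re + b * z.im → a * z.re + b * z.im < c + wν → z ∉ Ω)
    {z : ℂ} (hτ : |a * z.re - b * z.im - t₀| < wτ) (hν₁ : c - wν < (a : ℝ) * z.re + b * z.im)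
    (hν₂ : (a : ℝ) * z.re + b * z.im ≤ c) : z ∈ closure Ω := by
  rcases hν₂.lt_or_eq with h | h
  · exact subset_closure (hin z hτ hν₁ h)
  · exact frontier_subset_closure (frontier_of_line hΩ ha hb hwν hin hout hτ h)

/-- **The point of the line straight above a point of the lower box** is a frontier point of level `c` with
the same column, at distance `≤ c - level`. [folklore] -/
theorem exists_frontier_above (hΩ : IsOpen Ω) (ha : a = 1 ∨ a = -1) (hb : b = 1 ∨ b = -1) (hwν : 0 < wν)
    (hin : ∀ z : ℂ, |a * z.re - b * z.im - t₀| < wτ → c - wν < a * z.re + b * z.im → a * z.re + b * z.im < c → z ∈ Ω)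
    (hout : ∀ z : ℂ, |a * z.re - b * z.im - t₀| < wτ → c < a * z.re + b * z.im → a * z.re + b * z.im < c + wν → z ∉ Ω)
    {z : ℂ} (hτ : |a * z.re - b * z.im - t₀| < wτ) (hν : (a : ℝ) * z.re + b * z.im ≤ c) :
    ∃ f ∈ frontier Ω, (a : ℝ) * f.re + b * f.im = c ∧ (a : ℝ) * f.re - b * f.im = a * z.re - b * z.im ∧
      dist z f ≤ c - (a * z.re + b * z.im) := by
  set t : ℝ := (c - (a * z.re + b * z.im)) / 2 with ht
  have ht0 : 0 ≤ t := by rw [ht]; linarith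
  obtain ⟨h1, h2⟩ := level_add_normal ha hb z t
  have hc : (a : ℝ) * (z + t * (((a : ℝ) : ℂ) + ((b : ℝ) : ℂ) * I)).re + b * (z + t * (((a : ℝ) : ℂ) + ((b : ℝ) : ℂ) * I)).im = c := by
    rw [h1, ht]; ring
  refine ⟨z + (t : ℂ) * (((a : ℝ) : ℂ) + ((b : ℝ) : ℂ) * I), frontier_of_line hΩ ha hb hwν hin hout ?_ hc, hc, h2, ?_⟩
  · rw [h2]; exact hτ
  · have := dist_add_normal_le ha hb z t
    rw [abs_of_nonneg ht0] at this
    linarith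

/-! ## Mesh vertices and mesh-graph adjacency near the wall -/

/-- **Sites of level `≤ k` in the lower box are mesh vertices.** [folklore] -/
theorem mem_meshVertices_of_level_le (hδ : 0 < δ)
    (hin : ∀ z : ℂ, |a * z.re - b * z.im - t₀| < wτ → c - wν < a * z.re + b * z.im → a * z.re + b * z.im < c → z ∈ Ω)
    (hk : δ * k < c) (v : Site 2) (hτ : |δ * ((a * v 0 - b * v 1 : ℤ) : ℝ) - t₀| < wτ)
    (hν : c - wν < δ * ((a * v 0 + b * v 1 : ℤ) : ℝ)) (hlev : a * v 0 + b * v 1 ≤ k) : v ∈ meshVertices Ω δ := by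
  rw [mem_meshVertices_iff]
  refine hin _ ?_ ?_ ?_
  · rw [column_meshPoint]; exact hτ
  · rw [level_meshPoint]; exact hν
  · rw [level_meshPoint]
    have : ((a * v 0 + b * v 1 : ℤ) : ℝ) ≤ k := by exact_mod_cast hlev
    nlinarith

/-- **Sites of level `≥ k + 1` under the height `c + wν` are no mesh vertices.** [folklore] -/
theorem not_mem_meshVertices_of_lt_level (hΩ : IsOpen Ω) (ha : a = 1 ∨ a = -1) (hb : b = 1 ∨ b = -1) (hδ : 0 < δ)
    (hwν : 0 < wν)
    (hout : ∀ z : ℂ, |a * z.re - b * z.im - t₀| < wτ → c < a * z.re + b * z.im → a * z.re + b * z.im < c + wν → z ∉ Ω)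
    (hk' : c ≤ δ * (k + 1)) (v : Site 2) (hτ : |δ * ((a * v 0 - b * v 1 : ℤ) : ℝ) - t₀| < wτ)
    (hν : δ * ((a * v 0 + b * v 1 : ℤ) : ℝ) < c + wν) (hlev : k + 1 ≤ a * v 0 + b * v 1) : v ∉ meshVertices Ω δ := by
  rw [mem_meshVertices_iff]
  refine not_mem_of_le_level hΩ ha hb hwν hout ?_ ?_ ?_
  · rw [column_meshPoint]; exact hτ
  · rw [level_meshPoint]
    have : ((k : ℤ) : ℝ) + 1 ≤ ((a * v 0 + b * v 1 : ℤ) : ℝ) := by exact_mod_cast hlev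
    nlinarith
  · rw [level_meshPoint]; exact hν

/-- **Lattice neighbours in the closed lower box `{|column - t₀| ≤ 3wτ/4, c - 7wν/8 ≤ level ≤ c}` are mesh-graph
neighbours**: the box is convex and lies in `closure Ω`. [folklore] -/
theorem meshGraph_adj_of_mem_box (hΩ : IsOpen Ω) (ha : a = 1 ∨ a = -1) (hb : b = 1 ∨ b = -1) (hwτ : 0 < wτ)
    (hwν : 0 < wν)
    (hin : ∀ z : ℂ, |a * z.re - b * z.im - t₀| < wτ → c - wν < a * z.re + b * z.im → a * z.re + b * z.im < c → z ∈ Ω)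
    (hout : ∀ z : ℂ, |a * z.re - b * z.im - t₀| < wτ → c < a * z.re + b * z.im → a * z.re + b * z.im < c + wν → z ∉ Ω)
    {u w : Site 2} (huw : (zdGraph 2).Adj u w)
    (hu₁ : |δ * ((a * u 0 - b * u 1 : ℤ) : ℝ) - t₀| ≤ 3 * wτ / 4) (hu₂ : c - 7 * wν / 8 ≤ δ * ((a * u 0 + b * u 1 : ℤ) : ℝ))
    (hu₃ : δ * ((a * u 0 + b * u 1 : ℤ) : ℝ) ≤ c)
    (hw₁ : |δ * ((a * w 0 - b * w 1 : ℤ) : ℝ) - t₀| ≤ 3 * wτ / 4) (hw₂ : c - 7 * wν / 8 ≤ δ * ((a * w 0 + b * w 1 : ℤ) : ℝ))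
    (hw₃ : δ * ((a * w 0 + b * w 1 : ℤ) : ℝ) ≤ c) : (meshGraph Ω δ).Adj u w := by
  refine meshGraph_adj_iff.2 ⟨huw, ?_⟩
  rw [← column_meshPoint] at hu₁ hw₁
  rw [← level_meshPoint] at hu₂ hu₃ hw₂ hw₃
  rw [segment_subset_iff]
  intro p q hp hq hpq
  have hre : (p • meshPoint δ u + q • meshPoint δ w).re = p * (meshPoint δ u).re + q * (meshPoint δ w).re := by
    simp only [add_re, smul_re, smul_eq_mul]
  have him : (p • meshPoint δ u + q • meshPoint δ w).im = p * (meshPoint δ u).im + q * (meshPoint δ w).im := by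
    simp only [add_im, smul_im, smul_eq_mul]
  obtain ⟨hu₁l, hu₁r⟩ := abs_le.1 hu₁
  obtain ⟨hw₁l, hw₁r⟩ := abs_le.1 hw₁
  refine mem_closure_of_level_le hΩ ha hb hwν hin hout ?_ ?_ ?_
  · rw [hre, him, abs_lt]
    have e : (a : ℝ) * (p * (meshPoint δ u).re + q * (meshPoint δ w).re) - b * (p * (meshPoint δ u).im + q * (meshPoint δ w).im) - t₀ =
        p * ((a : ℝ) * (meshPoint δ u).re - b * (meshPoint δ u).im - t₀) +
          q * ((a : ℝ) * (meshPoint δ w).re - b * (meshPoint δ w).im - t₀) := by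
      have : t₀ = (p + q) * t₀ := by rw [hpq, one_mul]
      conv_lhs => rw [this]
      ring
    rw [e]
    constructor <;> nlinarith [mul_nonneg hp (by linarith : (0:ℝ) ≤ 3 * wτ / 4 - ((a : ℝ) * (meshPoint δ u).re - b * (meshPoint δ u).im - t₀)),
      mul_nonneg hq (by linarith : (0:ℝ) ≤ 3 * wτ / 4 - ((a : ℝ) * (meshPoint δ w).re - b * (meshPoint δ w).im - t₀)),
      mul_nonneg hp (by linarith : (0:ℝ) ≤ 3 * wτ / 4 + ((a : ℝ) * (meshPoint δ u).re - b * (meshPoint δ u).im - t₀)),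
      mul_nonneg hq (by linarith : (0:ℝ) ≤ 3 * wτ / 4 + ((a : ℝ) * (meshPoint δ w).re - b * (meshPoint δ w).im - t₀))]
  · rw [hre, him]
    have e : (a : ℝ) * (p * (meshPoint δ u).re + q * (meshPoint δ w).re) + b * (p * (meshPoint δ u).im + q * (meshPoint δ w).im) =
        p * ((a : ℝ) * (meshPoint δ u).re + b * (meshPoint δ u).im) + q * ((a : ℝ) * (meshPoint δ w).re + b * (meshPoint δ w).im) := by
      ring
    rw [e]
    have : c - wν = (p + q) * (c - wν) := by rw [hpq, one_mul]
    rw [this]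
    nlinarith [mul_nonneg hp (by linarith : (0:ℝ) ≤ ((a : ℝ) * (meshPoint δ u).re + b * (meshPoint δ u).im) - (c - 7 * wν / 8)),
      mul_nonneg hq (by linarith : (0:ℝ) ≤ ((a : ℝ) * (meshPoint δ w).re + b * (meshPoint δ w).im) - (c - 7 * wν / 8))]
  · rw [hre, him]
    have e : (a : ℝ) * (p * (meshPoint δ u).re + q * (meshPoint δ w).re) + b * (p * (meshPoint δ u).im + q * (meshPoint δ w).im) =
        p * ((a : ℝ) * (meshPoint δ u).re + b * (meshPoint δ u).im) + q * ((a : ℝ) * (meshPoint δ w).re + b * (meshPoint δ w).im) := by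
      ring
    rw [e]
    have : c = (p + q) * c := by rw [hpq, one_mul]
    rw [this]
    nlinarith [mul_nonneg hp (by linarith : (0:ℝ) ≤ c - ((a : ℝ) * (meshPoint δ u).re + b * (meshPoint δ u).im)),
      mul_nonneg hq (by linarith : (0:ℝ) ≤ c - ((a : ℝ) * (meshPoint δ w).re + b * (meshPoint δ w).im))]

/-- A boundary site strictly closer to `∂Ω ∖ arcA` than to `arcA` is off the discrete arc of `A`. [folklore] -/
theorem not_mem_zdArcA_of_lt {E : DiscreteDobrushin} {y : Site 2}
    (h : infDist (meshPoint E.δ y) (frontier E.Ω \ E.arcA) < infDist (meshPoint E.δ y) E.arcA) : y ∉ E.zdArcA := by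
  intro hy
  have := (E.mem_zdDiscreteArc_iff.1 hy).2
  linarith

/-- **Registered one-line ticket `stub_touch_wallB`** (helper B of `stub_touchLowerBound`): a boundary site strictly
closer to `∂Ω ∖ arcA` than to `arcA` is off the discrete wired arc. [folklore] -/
theorem stub_touch_wallB : ∀ (E : DiscreteDobrushin) (y : Site 2), Metric.infDist (meshPoint E.δ y) (frontier E.Ω \ E.arcA) < Metric.infDist (meshPoint E.δ y) E.arcA → y ∉ E.zdArcA :=
  fun _ _ h => not_mem_zdArcA_of_lt h

end Summit.CriticalPhenomena.CardyFormulaZ2.Theorems.ParafermionFamiliesToSLESix.TouchLowerBound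

end
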